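import Mathlib
import Literature.Computability.AlgebraicComplexity.DeterminantalConormalBoundProofs
import Summits.ValiantsHypothesis.ValiantsHypothesis.Theses.SymPencil

/-!
# `SymPencil.OneKernelLine` (stmt-ValiantsHypothesis-5679) — one kernel line

The route's support statement `OneKernelLine`: if `f = det A` with `A` a SYMMETRIC `m × m` matrix
of affine-linear forms over `ℂ` and `f(x) = 0`, then there is `u ∈ ℂ^m` with
`∂ᵢ f(x) = uᵀ Aᵢ u = Σ_{j,l} u_j (coeff_{Xᵢ} A_{jl}) u_l` for every variable `i`, where
`Aᵢ = (coeff_{Xᵢ} A_{jl})_{jl}` is the linear part of the pencil.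

Proof (Jacobi's formula + symmetric rank one): by the tree's Jacobi formula at a point
(`DeterminantalConormal.eval_pderiv_det`) `∂ᵢ f(x) = tr(adj A(x) · Aᵢ)`, the derivative matrices of
an affine pencil being the constant coefficient matrices
(`DeterminantalConormal.map_eval_pderiv_eq_of_isAffineDetRepr`). Since `det A(x) = f(x) = 0`,
either `adj A(x) = 0` (take `u = 0`) or, by the tree's kernel-pair lemma
(`DeterminantalConormal.exists_kernelPair_of_adjugate_ne_zero`), `adj A(x) = v wᵀ` with
`v, w ≠ 0`; as `A(x)` is symmetric so is its adjugate, whence `v = c • w` and, `ℂ` being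
algebraically closed, `c = s²`, so `adj A(x) = u uᵀ` with `u = s • w`
(`adjugate_eq_vecMulVec_self_of_isSymm`). Then `tr(u uᵀ Aᵢ) = uᵀ Aᵢ u`.
Sources: K. Sheshadri, arXiv:2606.11090 §1 (the one-kernel-line incidence for symmetric
pencils); Landsberg 2017 §6.4.5 (the two-line version). [folklore]
-/

namespace Summit.ValiantsHypothesis.ValiantsHypothesis.Theorems

open MvPolynomial Matrix Literature.Computability.AlgebraicComplexity

-- `Summit.ValiantsHypothesis.ValiantsHypothesis.…` is the tree's mandated single-conjunct layout (Sub = Summit).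
set_option linter.dupNamespace false

/-- **Symmetric rank one.** Over an algebraically closed field, the adjugate of a singular
SYMMETRIC square matrix `M` is a symmetric rank-`≤ 1` matrix, hence of the form `u uᵀ`
(`vecMulVec u u`): if `adj M ≠ 0` then `adj M = v wᵀ` with `v, w ≠ 0`
(`DeterminantalConormal.exists_kernelPair_of_adjugate_ne_zero`), symmetry of `adj M` forces
`v = c • w`, and `c = s²` gives `u = s • w`; if `adj M = 0` take `u = 0`. [folklore] -/
theorem adjugate_eq_vecMulVec_self_of_isSymm {K : Type*} [Field K] [IsAlgClosed K] {k : ℕ}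
    {M : Matrix (Fin k) (Fin k) K} (hM : M.IsSymm) (hdet : M.det = 0) :
    ∃ u : Fin k → K, M.adjugate = vecMulVec u u := by
  by_cases hadj : M.adjugate = 0
  · exact ⟨0, by rw [hadj, vecMulVec_zero]⟩
  obtain ⟨w, v, hw, -, -, -, hvw⟩ :=
    DeterminantalConormal.exists_kernelPair_of_adjugate_ne_zero hdet hadj
  -- the adjugate of a symmetric matrix is symmetric: `v a * w b = v b * w a`
  have hT : (vecMulVec v w)ᵀ = vecMulVec v w := by
    rw [← hvw, Matrix.adjugate_transpose, hM.eq]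
  have hsymm : ∀ a b, v a * w b = v b * w a := fun a b => by
    have h := congrFun (congrFun hT b) a
    simpa only [transpose_apply, vecMulVec_apply] using h
  obtain ⟨b₀, hb₀⟩ := Function.ne_iff.mp hw
  -- `v = c • w` with `c = v b₀ / w b₀`
  have hv : ∀ a, v a = v b₀ / w b₀ * w a := fun a => by
    rw [div_mul_eq_mul_div, eq_div_iff hb₀]
    exact hsymm a b₀
  obtain ⟨s, hs⟩ := IsAlgClosed.exists_pow_nat_eq (v b₀ / w b₀) two_pos
  refine ⟨s • w, ?_⟩
  rw [hvw]
  ext a b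
  simp only [vecMulVec_apply, Pi.smul_apply, smul_eq_mul]
  rw [hv a, ← hs]
  ring

/-- **`OneKernelLine` holds** (item stmt-ValiantsHypothesis-5679 of route SymPencil): for
`f = det A` with `A` a symmetric `m × m` matrix of affine-linear forms over `ℂ` and a zero `x` of
`f`, there is `u ∈ ℂ^m` with `∂ᵢ f(x) = Σ_j Σ_l u_j · coeff_{Xᵢ}(A_{jl}) · u_l` for every variable
`i` — Jacobi's formula `∂ᵢ det A(x) = tr(adj A(x) · Aᵢ)` with `adj A(x) = u uᵀ`
(`adjugate_eq_vecMulVec_self_of_isSymm`). (Sheshadri, arXiv:2606.11090 §1; Landsberg 2017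
§6.4.5.) [folklore] -/
theorem oneKernelLine_proof :
    Summit.ValiantsHypothesis.ValiantsHypothesis.Theses.SymPencil.OneKernelLine := by
  unfold Summit.ValiantsHypothesis.ValiantsHypothesis.Theses.SymPencil.OneKernelLine
  intro N _ f m A hsymm hA x hfx
  have hdet : (A.map (eval x)).det = 0 := by
    rw [DeterminantalConormal.det_map_eval, hA.2, hfx]
  have hMsymm : (A.map (eval x)).IsSymm := hsymm.map _
  obtain ⟨u, hu⟩ := adjugate_eq_vecMulVec_self_of_isSymm hMsymm hdet
  refine ⟨u, fun i => ?_⟩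
  rw [← hA.2, DeterminantalConormal.eval_pderiv_det,
    DeterminantalConormal.map_eval_pderiv_eq_of_isAffineDetRepr hA, hu, vecMulVec_mul,
    Matrix.trace_vecMulVec, dotProduct_comm, ← Matrix.dotProduct_mulVec]
  simp only [dotProduct, mulVec, Matrix.map_apply, Finset.mul_sum]
  refine Finset.sum_congr rfl fun j _ => Finset.sum_congr rfl fun l _ => ?_
  ring

end Summit.ValiantsHypothesis.ValiantsHypothesis.Theorems
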